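import Mathlib
import HarnessLib
import Literature.Probability.LatticeModels.IsingThermodynamics
import Summits.CriticalPhenomena.Ising3DConformalLimit.Theorems.PrecisionLaplacianDirectCorrelationStableTailPointwiseUpgradeAux

/-!
# Helpers (II) for the stub `stub_pointwiseUpgrade` of line `self-energy-pick-inversion`
(crux `PrecisionLaplacian.DirectCorrelationStableTail`, item stmt-CriticalPhenomena-4799)

The POINTWISE LIMIT step of the soft-analysis upgrade.  For a profile `h : ℤ³ → ℝ` which is
slowly varying at scale ((R2): `|h x - h y| ≤ ε` once `|x|₂ ≥ R₀`, `|x - y|₂ ≤ δ |x|₂`) we show: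
* `approx_rounding`: lattice points `y` with `‖y - N u‖∞ ≤ δ' N` satisfy `|h y - h ⌊N u⌋| ≤ ε`
  for `N ≥ N₁`, uniformly in the unit vector `u`;
* bump test functions `f_{u,ρ}(v) = max 0 (1 - dist v u / ρ)` and the weights
  `F(v) = max |v|₂ (1/2) ^ (η - 5) · f_{u,ρ}(v)`: continuity, compact support away from `0`;
* `rescaled_term_eq`: `N^{2-η} a(y) f(y/N) = h(y) · N⁻³ F(y/N)` when `h = a · |·|₂^{5-η}`;
* `cauchySeq_profile`: if moreover the tail functionals `N^{2-η} ∑' a(y) f(y/N)` converge for every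
  continuous compactly supported `f` vanishing near `0`, then `N ↦ h ⌊N u⌋` is a Cauchy sequence
  (compare `Λ_N(f_{u,ρ})` with `h ⌊N u⌋ · N⁻³ ∑ F(y/N)` and use the lattice Riemann-sum lemma).

No definitions are introduced; all statements are folklore soft analysis
(cf. Meerschaert–Scheffler 2001, ch. 8, for the measure-level notion of regular variation).
-/

noncomputable section

namespace Summit.CriticalPhenomena.Ising3DConformalLimit.Cruxes.DirectCorrelationStableTail.SelfEnergyPickInversion

open MeasureTheory Filter Topology
open scoped BigOperators Pointwise
open Literature.Probability.LatticeModels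

/-! ### Consequence of regularity at scale (R2) -/

/-- **Rounding lemma.** If `h` is slowly varying at scale (hypothesis (R2)), then for every `ε > 0`
there are `δ' > 0` and `N₁` such that for all `N ≥ N₁`, all unit vectors `u` and all lattice points
`y` with `‖y - N u‖∞ ≤ δ' N` one has `|h y - h ⌊N u⌋| ≤ ε`. [folklore] -/
theorem approx_rounding (h : Site 3 → ℝ)
    (hR2 : ∀ ε : ℝ, 0 < ε → ∃ δ : ℝ, 0 < δ ∧ ∃ R₀ : ℝ, ∀ x y : Site 3,
      R₀ ≤ √(∑ j, ((x j : ℝ)) ^ 2) → √(∑ j, (((x - y) j : ℝ)) ^ 2) ≤ δ * √(∑ j, ((x j : ℝ)) ^ 2) →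
      |h x - h y| ≤ ε)
    (ε : ℝ) (hε : 0 < ε) :
    ∃ δ' : ℝ, 0 < δ' ∧ ∃ N₁ : ℕ, ∀ N : ℕ, N₁ ≤ N → ∀ u : Fin 3 → ℝ, ∑ i, u i ^ 2 = 1 →
      ∀ y : Site 3, ‖(fun j => (y j : ℝ) - N * u j)‖ ≤ δ' * N →
      |h y - h (fun i => ⌊(N : ℝ) * u i⌋)| ≤ ε := by
  obtain ⟨δ, hδ, R₀, H⟩ := hR2 ε hε
  refine ⟨δ / 4, by positivity, ⌈|R₀| + 4 / δ + 6⌉₊, fun N hN u hu y hy => ?_⟩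
  have hN' : |R₀| + 4 / δ + 6 ≤ N := (Nat.le_ceil _).trans (by exact_mod_cast hN)
  have hN0 : (0 : ℝ) ≤ N := Nat.cast_nonneg N
  -- the rounded point `r = ⌊N u⌋`
  have hr_ge : (N : ℝ) - 2 ≤ √(∑ j, (((⌊(N : ℝ) * u j⌋ : ℤ) : ℝ)) ^ 2) :=
    sub_two_le_sqrt_sum_sq_floor hu hN0
  -- distance from `r` to `y`
  have hdist : √(∑ j, (((⌊(N : ℝ) * u j⌋ : ℤ) : ℝ) - (y j : ℝ)) ^ 2) ≤ 2 + δ / 2 * N := by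
    have h1 : √(∑ j, (((⌊(N : ℝ) * u j⌋ : ℤ) : ℝ) - (y j : ℝ)) ^ 2) ≤
        √(∑ j, (((⌊(N : ℝ) * u j⌋ : ℤ) : ℝ) - N * u j) ^ 2) +
          √(∑ j, ((N : ℝ) * u j - (y j : ℝ)) ^ 2) := sqrt_sum_sq_sub_le_add _ _ _
    have h2 : √(∑ j, (((⌊(N : ℝ) * u j⌋ : ℤ) : ℝ) - N * u j) ^ 2) ≤ 2 :=
      sqrt_sum_sq_floor_sub_le (fun j => (N : ℝ) * u j)
    have h3 : √(∑ j, ((N : ℝ) * u j - (y j : ℝ)) ^ 2) ≤ 2 * (δ / 4 * N) := by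
      refine (sqrt_sum_sq_le_two_mul_norm (fun j => (N : ℝ) * u j - (y j : ℝ))).trans ?_
      refine mul_le_mul_of_nonneg_left ?_ zero_le_two
      have : (fun j => (N : ℝ) * u j - (y j : ℝ)) = -(fun j => (y j : ℝ) - N * u j) := by
        funext j
        simp
      rwa [this, norm_neg]
    linarith
  have habs : |R₀| ≥ R₀ := le_abs_self R₀
  have h4δ : 0 ≤ 4 / δ := by positivity
  have h4d : 4 / δ * δ = 4 := div_mul_cancel₀ 4 hδ.ne'
  have e : √(∑ j, ((((fun i => ⌊(N : ℝ) * u i⌋ : Site 3) - y) j : ℤ) : ℝ) ^ 2) =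
      √(∑ j, (((⌊(N : ℝ) * u j⌋ : ℤ) : ℝ) - (y j : ℝ)) ^ 2) := by
    congr 1
    refine Finset.sum_congr rfl fun j _ => ?_
    simp only [Pi.sub_apply, Int.cast_sub]
  have hδN : 4 + 6 * δ ≤ δ * N := by
    have h6 : δ * (4 / δ) = 4 := by field_simp
    have h7 : 4 / δ + 6 ≤ (N : ℝ) := by linarith [abs_nonneg R₀]
    nlinarith [mul_le_mul_of_nonneg_left h7 hδ.le]
  have key := H (fun i => ⌊(N : ℝ) * u i⌋) y (by linarith) (by
    rw [e]
    refine hdist.trans ?_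
    have h5 : δ * ((N : ℝ) - 2) ≤ δ * √(∑ j, (((⌊(N : ℝ) * u j⌋ : ℤ) : ℝ)) ^ 2) :=
      mul_le_mul_of_nonneg_left hr_ge hδ.le
    have h8 : δ / 2 * (N : ℝ) = δ * N / 2 := by ring
    rw [h8]
    linarith)
  rwa [abs_sub_comm] at key

/-! ### Bump test functions -/

/-- The bump `v ↦ max 0 (1 - dist v u / ρ)` is continuous. [folklore] -/
theorem continuous_bump (u : Fin 3 → ℝ) (ρ : ℝ) :
    Continuous fun v : Fin 3 → ℝ => max 0 (1 - dist v u / ρ) := by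
  fun_prop

/-- Off the open ball `dist v u < ρ` the bump vanishes. [folklore] -/
theorem dist_lt_of_bump_ne_zero {u v : Fin 3 → ℝ} {ρ : ℝ} (hρ : 0 < ρ)
    (h : max 0 (1 - dist v u / ρ) ≠ 0) : dist v u < ρ := by
  by_contra hle
  push Not at hle
  have : 1 - dist v u / ρ ≤ 0 := by
    rw [sub_nonpos, le_div_iff₀ hρ, one_mul]
    exact hle
  exact h (max_eq_left this)

/-- The bump is nonnegative. [folklore] -/
theorem bump_nonneg (u v : Fin 3 → ℝ) (ρ : ℝ) : 0 ≤ max 0 (1 - dist v u / ρ) := le_max_left _ _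

/-- The bump has compact support (inside the closed ball of radius `ρ` about `u`). [folklore] -/
theorem hasCompactSupport_bump (u : Fin 3 → ℝ) {ρ : ℝ} (hρ : 0 < ρ) :
    HasCompactSupport fun v : Fin 3 → ℝ => max 0 (1 - dist v u / ρ) := by
  refine HasCompactSupport.intro (isCompact_closedBall u ρ) fun v hv => ?_
  by_contra hne
  exact hv (Metric.mem_closedBall.2 (dist_lt_of_bump_ne_zero hρ hne).le)

/-- The topological support of the bump stays inside the closed `ρ`-ball about `u`. [folklore] -/
theorem tsupport_bump_subset (u : Fin 3 → ℝ) {ρ : ℝ} (hρ : 0 < ρ) :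
    tsupport (fun v : Fin 3 → ℝ => max 0 (1 - dist v u / ρ)) ⊆ Metric.closedBall u ρ :=
  closure_minimal (fun _ hv => Metric.mem_closedBall.2 (dist_lt_of_bump_ne_zero hρ hv).le)
    Metric.isClosed_closedBall

/-- For `u` on the unit sphere and `ρ ≤ 1/4` the bump vanishes near the origin. [folklore] -/
theorem zero_notMem_tsupport_bump {u : Fin 3 → ℝ} (hu : ∑ i, u i ^ 2 = 1) {ρ : ℝ} (hρ : 0 < ρ)
    (hρ4 : ρ ≤ 1 / 4) :
    (0 : Fin 3 → ℝ) ∉ tsupport (fun v : Fin 3 → ℝ => max 0 (1 - dist v u / ρ)) := by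
  intro h0
  have h1 := Metric.mem_closedBall.1 (tsupport_bump_subset u hρ h0)
  rw [dist_comm, dist_zero_right] at h1
  have h2 := half_le_norm_of_sphere hu
  linarith

/-- The weight `F(v) = max |v|₂ (1/2) ^ (η-5) · f(v)` is continuous if `f` is. [folklore] -/
theorem continuous_weight (η : ℝ) {f : (Fin 3 → ℝ) → ℝ} (hf : Continuous f) :
    Continuous fun v : Fin 3 → ℝ => max (√(∑ j, v j ^ 2)) (1 / 2) ^ (η - 5) * f v := by
  refine Continuous.mul (Continuous.rpow_const (by fun_prop) fun v => Or.inl ?_) hf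
  exact (lt_of_lt_of_le (by norm_num) (le_max_right _ _)).ne'

/-- The weight is nonnegative if `f` is. [folklore] -/
theorem weight_nonneg (η : ℝ) {f : (Fin 3 → ℝ) → ℝ} (hf : ∀ v, 0 ≤ f v) (v : Fin 3 → ℝ) :
    0 ≤ max (√(∑ j, v j ^ 2)) (1 / 2) ^ (η - 5) * f v :=
  mul_nonneg (Real.rpow_nonneg (le_trans (by norm_num) (le_max_right _ _)) _) (hf v)

/-- At the centre `u` of the bump (a unit vector) the weight equals `1`. [folklore] -/
theorem weight_bump_self {u : Fin 3 → ℝ} (hu : ∑ i, u i ^ 2 = 1) (η ρ : ℝ) :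
    max (√(∑ j, u j ^ 2)) (1 / 2) ^ (η - 5) * max 0 (1 - dist u u / ρ) = 1 := by
  rw [sqrt_sum_sq_eq_one hu, max_eq_left (by norm_num : (1 / 2 : ℝ) ≤ 1), Real.one_rpow, dist_self,
    zero_div, sub_zero, max_eq_right zero_le_one, mul_one]

/-! ### The rescaled identity `N^{2-η} a(y) f(y/N) = h(y) N⁻³ F(y/N)` -/

/-- A point of the support of the bump `f_{u,ρ}` (`u` a unit vector, `ρ ≤ 1/4`) has Euclidean norm
more than `1/2`. [folklore] -/
theorem half_lt_sqrt_sum_sq_of_bump_ne_zero {u : Fin 3 → ℝ} (hu : ∑ i, u i ^ 2 = 1) {ρ : ℝ}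
    (hρ : 0 < ρ) (hρ4 : ρ ≤ 1 / 4) {v : Fin 3 → ℝ} (hv : max 0 (1 - dist v u / ρ) ≠ 0) :
    1 / 2 < √(∑ j, v j ^ 2) := by
  have hd := dist_lt_of_bump_ne_zero hρ hv
  have h1 : √(∑ j, u j ^ 2) ≤ √(∑ j, v j ^ 2) + √(∑ j, (u j - v j) ^ 2) :=
    sqrt_sum_sq_le_add_sub _ _
  rw [sqrt_sum_sq_eq_one hu] at h1
  have h2 := sqrt_sum_sq_le_two_mul_norm (fun j => u j - v j)
  have h3 : ‖(fun j => u j - v j)‖ = dist v u := by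
    rw [dist_comm, dist_eq_norm]
    rfl
  rw [h3] at h2
  linarith

/-- **Rescaled identity.** With `h(y) = a(y) |y|₂^{5-η}`, `f = f_{u,ρ}` and
`F(v) = max |v|₂ (1/2) ^ (η-5) f(v)`: `N^{2-η} a(y) f(y/N) = h(y) · F(y/N) / N³`. [folklore] -/
theorem rescaled_term_eq (a : Site 3 → ℝ) (η : ℝ) {u : Fin 3 → ℝ} (hu : ∑ i, u i ^ 2 = 1) {ρ : ℝ}
    (hρ : 0 < ρ) (hρ4 : ρ ≤ 1 / 4) {N : ℕ} (hN : 0 < N) (y : Site 3) :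
    (N : ℝ) ^ (2 - η) * (a y * max 0 (1 - dist (fun j => (y j : ℝ) / N) u / ρ)) =
      a y * √(∑ j, ((y j : ℝ)) ^ 2) ^ (5 - η) *
        (max (√(∑ j, ((y j : ℝ) / N) ^ 2)) (1 / 2) ^ (η - 5) *
          max 0 (1 - dist (fun j => (y j : ℝ) / N) u / ρ) / (N : ℝ) ^ 3) := by
  by_cases hf : max 0 (1 - dist (fun j => (y j : ℝ) / N) u / ρ) = 0
  · rw [hf]
    simp
  have hNpos : (0 : ℝ) < N := by exact_mod_cast hN
  have hE : 1 / 2 < √(∑ j, ((y j : ℝ) / N) ^ 2) :=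
    half_lt_sqrt_sum_sq_of_bump_ne_zero hu hρ hρ4 (v := fun j => (y j : ℝ) / N) hf
  set e : ℝ := √(∑ j, ((y j : ℝ) / N) ^ 2) with he_def
  have hepos : 0 < e := lt_trans (by norm_num) hE
  have hmax : max e (1 / 2) = e := max_eq_left hE.le
  have hscale : √(∑ j, ((y j : ℝ)) ^ 2) = N * e := by
    have := sqrt_sum_sq_const_mul (N : ℝ) (fun j => (y j : ℝ) / N)
    rw [abs_of_pos hNpos] at this
    rw [he_def, ← this]
    congr 1
    refine Finset.sum_congr rfl fun j _ => ?_
    rw [mul_div_cancel₀ _ hNpos.ne']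
  rw [hmax, hscale, Real.mul_rpow hNpos.le hepos.le]
  have h1 : e ^ (5 - η) * e ^ (η - 5) = 1 := by
    rw [← Real.rpow_add hepos]
    norm_num
  have h2 : (N : ℝ) ^ (5 - η) = (N : ℝ) ^ (2 - η) * (N : ℝ) ^ 3 := by
    rw [← Real.rpow_natCast, ← Real.rpow_add hNpos]
    congr 1
    push_cast
    ring
  have h3 : (N : ℝ) ^ 3 ≠ 0 := pow_ne_zero 3 hNpos.ne'
  rw [h2]
  set fv : ℝ := max 0 (1 - dist (fun j => (y j : ℝ) / N) u / ρ) with hfv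
  calc (N : ℝ) ^ (2 - η) * (a y * fv) = a y * fv * (N : ℝ) ^ (2 - η) * 1 * 1 := by ring
    _ = a y * fv * (N : ℝ) ^ (2 - η) * (e ^ (5 - η) * e ^ (η - 5)) *
        ((N : ℝ) ^ 3 / (N : ℝ) ^ 3) := by rw [h1, div_self h3]
    _ = _ := by ring

/-! ### A finite-sum estimate -/

/-- If `|p y - m| ≤ ε` wherever the nonnegative weight `q y` is non-zero, then
`|∑ p q - m ∑ q| ≤ ε ∑ q`. [folklore] -/
theorem abs_sum_mul_sub_mul_sum_le {B : Finset (Site 3)} (p q : Site 3 → ℝ) (m ε : ℝ)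
    (hq : ∀ y, 0 ≤ q y) (hp : ∀ y ∈ B, q y ≠ 0 → |p y - m| ≤ ε) :
    |∑ y ∈ B, p y * q y - m * ∑ y ∈ B, q y| ≤ ε * ∑ y ∈ B, q y := by
  rw [Finset.mul_sum, ← Finset.sum_sub_distrib, Finset.mul_sum]
  refine (Finset.abs_sum_le_sum_abs _ _).trans (Finset.sum_le_sum fun y hy => ?_)
  rw [← sub_mul, abs_mul, abs_of_nonneg (hq y)]
  by_cases hqy : q y = 0
  · simp [hqy]
  · exact mul_le_mul_of_nonneg_right (hp y hy hqy) (hq y)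

/-! ### The pointwise limit along rounded rays -/

/-- **Cauchy property of the profile along rounded rays.** Let `h = a · |·|₂^{5-η}` satisfy the
conclusion of `approx_rounding` and let the tail functionals `N^{2-η} ∑' a(y) f(y/N)` converge for
every continuous compactly supported `f` vanishing near `0`. Then for every unit vector `u` the
sequence `N ↦ h ⌊N u⌋` is Cauchy. [folklore] -/
theorem cauchySeq_profile (a : Site 3 → ℝ) (η : ℝ) (h : Site 3 → ℝ)
    (hh : ∀ x, h x = a x * √(∑ j, ((x j : ℝ)) ^ 2) ^ (5 - η))
    (hG : ∀ ε : ℝ, 0 < ε → ∃ δ' : ℝ, 0 < δ' ∧ ∃ N₁ : ℕ, ∀ N : ℕ, N₁ ≤ N → ∀ u : Fin 3 → ℝ,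
      ∑ i, u i ^ 2 = 1 → ∀ y : Site 3, ‖(fun j => (y j : ℝ) - N * u j)‖ ≤ δ' * N →
      |h y - h (fun i => ⌊(N : ℝ) * u i⌋)| ≤ ε)
    (hTMC : ∀ f : (Fin 3 → ℝ) → ℝ, Continuous f → HasCompactSupport f →
      (0 : Fin 3 → ℝ) ∉ tsupport f → ∃ L : ℝ,
      Tendsto (fun R : ℕ => (R : ℝ) ^ (2 - η) * ∑' x : Site 3, a x * f (fun j => (x j : ℝ) / (R : ℝ)))
        atTop (nhds L))
    (u : Fin 3 → ℝ) (hu : ∑ i, u i ^ 2 = 1) :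
    CauchySeq (fun N : ℕ => h (fun i => ⌊(N : ℝ) * u i⌋)) := by
  refine Metric.cauchySeq_iff'.2 fun ε hε => ?_
  obtain ⟨δ', hδ', N₁, hN₁⟩ := hG (ε / 4) (by positivity)
  -- the bump `f = f_{u,ρ}` and the weight `F`
  set ρ : ℝ := min (1 / 4) δ' with hρ_def
  have hρ : 0 < ρ := lt_min (by norm_num) hδ'
  have hρ4 : ρ ≤ 1 / 4 := min_le_left _ _
  have hρδ : ρ ≤ δ' := min_le_right _ _
  set f : (Fin 3 → ℝ) → ℝ := fun v => max 0 (1 - dist v u / ρ) with hf_def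
  set F : (Fin 3 → ℝ) → ℝ := fun v => max (√(∑ j, v j ^ 2)) (1 / 2) ^ (η - 5) * f v with hF_def
  have hfc : Continuous f := continuous_bump u ρ
  have hfs : HasCompactSupport f := hasCompactSupport_bump u hρ
  have hFc : Continuous F := continuous_weight η hfc
  have hFs : HasCompactSupport F := hfs.mul_left
  have hF0 : ∀ v, 0 ≤ F v := weight_nonneg η (fun v => bump_nonneg u v ρ)
  have hFu : F u ≠ 0 := by
    simp only [hF_def, hf_def, weight_bump_self hu]
    exact one_ne_zero
  obtain ⟨L, hL⟩ := hTMC f hfc hfs (zero_notMem_tsupport_bump hu hρ hρ4)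
  have hI := tendsto_lattice_sum_div_cube F hFc hFs
  have hIpos : 0 < ∫ v, F v := hFc.integral_pos_of_hasCompactSupport_nonneg_nonzero hFs hF0 hFu
  -- the key estimate `|Λ_N - h ⌊N u⌋ I_N| ≤ ε/4 · I_N`
  have hkey : ∀ N : ℕ, max N₁ 1 ≤ N →
      |(N : ℝ) ^ (2 - η) * (∑' x : Site 3, a x * f (fun j => (x j : ℝ) / (N : ℝ))) -
        h (fun i => ⌊(N : ℝ) * u i⌋) * ((∑' y : Site 3, F (fun j => (y j : ℝ) / N)) / (N : ℝ) ^ 3)|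
        ≤ ε / 4 * ((∑' y : Site 3, F (fun j => (y j : ℝ) / N)) / (N : ℝ) ^ 3) := by
    intro N hN
    have hN1 : 0 < N := lt_of_lt_of_le one_pos ((le_max_right _ _).trans hN)
    have hNpos : (0 : ℝ) < N := by exact_mod_cast hN1
    obtain ⟨B, hB⟩ := exists_finset_support_rescaled f hfs hN1
    have hBF : ∀ y : Site 3, y ∉ B → F (fun j => (y j : ℝ) / N) = 0 := fun y hy => by
      simp only [hF_def, hB y hy, mul_zero]
    rw [tsum_eq_sum (fun y hy => by rw [hB y hy, mul_zero]), tsum_eq_sum hBF, Finset.mul_sum,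
      Finset.sum_div]
    have hterm : ∀ y ∈ B, (N : ℝ) ^ (2 - η) * (a y * f (fun j => (y j : ℝ) / N)) =
        h y * (F (fun j => (y j : ℝ) / N) / (N : ℝ) ^ 3) := fun y _ => by
      rw [hh y]
      exact rescaled_term_eq a η hu hρ hρ4 hN1 y
    rw [Finset.sum_congr rfl hterm]
    refine abs_sum_mul_sub_mul_sum_le _ _ _ _ (fun y => div_nonneg (hF0 _) (pow_nonneg hNpos.le 3))
      fun y _ hq => ?_
    have hfy : f (fun j => (y j : ℝ) / N) ≠ 0 := by
      intro h0
      apply hq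
      simp only [hF_def, h0, mul_zero, zero_div]
    refine hN₁ N ((le_max_left _ _).trans hN) u hu y ?_
    have hd : dist (fun j => (y j : ℝ) / N) u < ρ := dist_lt_of_bump_ne_zero hρ hfy
    have e : (fun j => (y j : ℝ) - N * u j) = (N : ℝ) • ((fun j => (y j : ℝ) / N) - u) := by
      funext j
      simp only [Pi.smul_apply, Pi.sub_apply, smul_eq_mul]
      rw [mul_sub, mul_div_cancel₀ _ hNpos.ne']
    rw [e, norm_smul, Real.norm_eq_abs, abs_of_pos hNpos, ← dist_eq_norm, mul_comm]
    exact mul_le_mul_of_nonneg_right (hd.le.trans hρδ) hNpos.le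
  -- consequences: `|Λ_N / I_N - h ⌊N u⌋| ≤ ε / 4` eventually, and `Λ_N / I_N` converges
  set Λ : ℕ → ℝ := fun N =>
    (N : ℝ) ^ (2 - η) * ∑' x : Site 3, a x * f (fun j => (x j : ℝ) / (N : ℝ)) with hΛ_def
  set I : ℕ → ℝ := fun N => (∑' y : Site 3, F (fun j => (y j : ℝ) / N)) / (N : ℝ) ^ 3 with hI_def
  have hq : Tendsto (fun N => Λ N / I N) atTop (𝓝 (L / ∫ v, F v)) := hL.div hI hIpos.ne'
  obtain ⟨N₂, hN₂⟩ := Metric.cauchySeq_iff.1 hq.cauchySeq (ε / 4) (by positivity)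
  obtain ⟨N₃, hN₃⟩ := eventually_atTop.1 (hI.eventually (lt_mem_nhds (half_lt_self hIpos)))
  have hclose : ∀ N : ℕ, max (max N₁ 1) N₃ ≤ N →
      |h (fun i => ⌊(N : ℝ) * u i⌋) - Λ N / I N| ≤ ε / 4 := by
    intro N hN
    have hIN : 0 < I N := lt_trans (half_pos hIpos) (hN₃ N ((le_max_right _ _).trans hN))
    have hk : |Λ N - h (fun i => ⌊(N : ℝ) * u i⌋) * I N| ≤ ε / 4 * I N :=
      hkey N ((le_max_left _ _).trans hN)
    have e : h (fun i => ⌊(N : ℝ) * u i⌋) - Λ N / I N =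
        (h (fun i => ⌊(N : ℝ) * u i⌋) * I N - Λ N) / I N := by
      field_simp
    rw [e, abs_div, abs_of_pos hIN, div_le_iff₀ hIN, abs_sub_comm]
    exact hk
  refine ⟨max (max (max N₁ 1) N₃) N₂, fun n hn => ?_⟩
  have hn' : max (max N₁ 1) N₃ ≤ n := (le_max_left _ _).trans hn
  have hM' : max (max N₁ 1) N₃ ≤ max (max (max N₁ 1) N₃) N₂ := le_max_left _ _
  have h1 := hclose n hn'
  have h2 := hclose _ hM'
  have h3 := hN₂ n ((le_max_right _ _).trans hn) (max (max (max N₁ 1) N₃) N₂) (le_max_right _ _)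
  rw [Real.dist_eq] at h3 ⊢
  rw [abs_le] at h1 h2
  rw [abs_lt] at h3 ⊢
  constructor <;> linarith [h1.1, h1.2, h2.1, h2.2, h3.1, h3.2]

/-- **Registered helper sub-goal `stub_pointwiseUpgrade_auxCauchy`** of stub `stub_pointwiseUpgrade`
(line `self-energy-pick-inversion`, crux stmt-CriticalPhenomena-4799): for `h = a |·|₂^{5-η}`
satisfying the rounding lemma, convergence of the tail functionals `N^{2-η} ∑' a(y) f(y/N)` for all
continuous compactly supported `f` vanishing near `0` makes `N ↦ h ⌊N u⌋` Cauchy for every unit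
vector `u`. [folklore] -/
theorem stub_pointwiseUpgrade_auxCauchy :
    ∀ (a h : Site 3 → ℝ) (η : ℝ), (∀ x : Site 3, h x = a x * Real.sqrt (∑ j, ((x) j : ℝ) ^ 2) ^ (5 -
      η)) → (∀ ε : ℝ, 0 < ε → ∃ δ' : ℝ, 0 < δ' ∧ ∃ N₁ : ℕ, ∀ N : ℕ, N₁ ≤ N → ∀ u : Fin 3 → ℝ, ∑ i, u
      i ^ 2 = 1 → ∀ y : Site 3, ‖(fun j => (y j : ℝ) - (N : ℝ) * u j)‖ ≤ δ' * (N : ℝ) → |h y - h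
      (fun i => ⌊(N : ℝ) * u i⌋)| ≤ ε) → (∀ f : (Fin 3 → ℝ) → ℝ, Continuous f → HasCompactSupport f
      → (0 : Fin 3 → ℝ) ∉ tsupport f → ∃ L : ℝ, Filter.Tendsto (fun R : ℕ => (R : ℝ) ^ (2 - η) * ∑'
      x : Site 3, a x * f (fun j => (x j : ℝ) / (R : ℝ))) Filter.atTop (nhds L)) → ∀ u : Fin 3 → ℝ,
      ∑ i, u i ^ 2 = 1 → CauchySeq (fun N : ℕ => h (fun i => ⌊(N : ℝ) * u i⌋)) :=
  fun a h η hh hG hTMC u hu => cauchySeq_profile a η h hh hG hTMC u hu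

end Summit.CriticalPhenomena.Ising3DConformalLimit.Cruxes.DirectCorrelationStableTail.SelfEnergyPickInversion

end
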